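import Summits.BirchSwinnertonDyer.BirchSwinnertonDyer.Theorems.CyclotomicUntwistRohrlichFamilyAtLevel
import Summits.BirchSwinnertonDyer.BirchSwinnertonDyer.Theorems.CyclotomicUntwistNonvanishingTwistsAtLevel
import Literature.NumberTheory.EllipticCurves.RohrlichNonvanishingProofs
import HarnessLib

/-!
# Rohrlich's non-vanishing theorem for twists of `p`-power conductor at ANY prime `p` — rational
# newforms and elliptic curves over `ℚ` (the hypothesis `p ∤ N` removed)

Cell `pub/bsd-wall` (D-0145 line `route-BirchSwinnertonDyer-CyclotomicUntwist`), seat `bsd-line-cycu-p5`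
(width seat 5), helper toward crux K1 `PSRankOneLowerHalfAtThree` (stmt-BirchSwinnertonDyer-21580), D1
currency. THEOREMS ONLY (no definition, no named fact, no `sorry`); BSD is not proved by this file and
no crux is.

The tree's `Rohrlich1984_primePow_of_coeffField_eq_bot` / `Rohrlich1984_primePow_of_isNewformOf`
(`RohrlichNonvanishingProofs`) prove Rohrlich's theorem (Invent. Math. 75 (1984), Theorem p. 409:
only finitely many primitive `χ` of `p`-power conductor have `L(f, χ, 1) = 0`) for rational
newforms / newforms of elliptic curves under `p ∤ N`, the restriction of the 1984 paper (twists
ramified at the level are Rohrlich, Invent. Math. 97 (1989)). Here `p ∤ N` is REMOVED, by running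
Rohrlich's own argument — Galois conjugation of a vanishing value (`twistedSymbolSum_pow_eq_zero_of_coprime`),
the sub-coset family `χ⟨χ^{p(p-1)}⟩`, the first moment over it — with the approximate functional
equation flipped by the Atkin–Lehner involution at the prime-to-`p` part `Q ∥ N` instead of the
Fricke involution (`exists_forall_family_exists_twistedSymbolSum_ne_zero_atkinLehner`, companion
`CyclotomicUntwistRohrlichFamilyAtLevel`; newforms are `w_Q`-eigen, Knapp 1993 Thm. 9.27(b),
`IsNewform0.exists_atkinLehnerInvolution_eq_smul`):

* `rohrlich_primePow_atkinLehner` — for `f ∈ S₂(Γ₀(N))` a normalised newform with rational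
  coefficients, `|aₙ| ≤ C n^θ` (`θ < 2/3`), `w_Q f = w f` at `Q ∥ N` with `p ∤ Q`, `N ∣ Q p^{m₁}`:
  `Set.Finite {χ primitive of p-power conductor | L(f, χ, 1) = 0}`;
* `rohrlich_primePow_of_coeffBound` — the same with the Atkin–Lehner data produced internally
  (`Q = N / p^{v_p(N)}`): **Rohrlich's theorem for rational newforms at ANY prime `p`**;
* `rohrlich_primePow_of_isNewformOf` — **for the newform of an elliptic curve `E/ℚ` and ANY prime
  `p` (good or bad), only finitely many primitive `χ` of `p`-power conductor have `L(E, χ, 1) = 0`**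
  (Hasse bound `θ = 5/8`); the exact shape of `Rohrlich1984_nonvanishing_twists.primePow` without
  `p ∤ N`, and of the hypothesis `hR` of `PSUntwistNonvanishing.exists_apply_ne_zero_of_rohrlich`;
* consequently seat cycu-p1's `exists_apply_ne_zero_of_isPSCyclotomicLFunctionOf hμ hη hα hR` applies
  with `hR := fun _ hf ↦ rohrlich_primePow_of_isNewformOf (p := 3) hf` — a second road to the
  already-landed `PSUntwistNonvanishingUnconditional.exists_apply_ne_zero_of_isPSCyclotomicLFunctionOf'`
  (not restated here: same statement).

References: D. E. Rohrlich, Invent. Math. 75 (1984), 409–423, Theorem p. 409 and §§1–4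
[cite: RohrlichInventiones1984, Theorem (p. 409)]; A. W. Knapp, *Elliptic curves* (1993), Thm. 9.27
[cite: Knapp1993, Thm. 9.27]; B. Mazur, J. Tate, J. Teitelbaum, Invent. Math. 84 (1986), §I.17.
-/

noncomputable section

open scoped BigOperators Real

open CongruenceSubgroup UpperHalfPlane Complex MeasureTheory Set Finset Filter Topology
  Literature.NumberTheory.EllipticCurves Literature.NumberTheory.EllipticCurves.ModularForms
  Summit.BirchSwinnertonDyer.BirchSwinnertonDyer.Theorems.PSNonvanishingAtLevel

-- single-conjunct summit: `Summit.BirchSwinnertonDyer.BirchSwinnertonDyer.…` repeats the name by design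
set_option linter.dupNamespace false
set_option autoImplicit false

namespace Summit.BirchSwinnertonDyer.BirchSwinnertonDyer.Theorems.PSRohrlichAtLevel

section Main

variable {N : ℕ} [NeZero N] {f : CuspForm (Gamma0 N) 2} {p : ℕ} [hp : Fact p.Prime]

/-- **Rohrlich's non-vanishing theorem with an Atkin–Lehner flip** (rational newforms, twists of
`p`-power conductor, `p` possibly dividing the level). Let `f ∈ S₂(Γ₀(N))` be a normalised newform
with rational coefficients, `|aₙ(f)| ≤ C n^θ` for some `θ < 2/3`, and `w_Q f = w f` (`w² = 1`) for an
exact divisor `Q ∥ N` with `p ∤ Q` and `N ∣ Q p^{m₁}`. Then only finitely many primitive Dirichlet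
characters `χ` of `p`-power conductor have `L(f, χ, 1) = 0`. Proof = that of
`Rohrlich1984_primePow_of_coeffField_eq_bot` (Rohrlich 1984: Birch, Galois conjugation over the
rational period lattice, the sub-coset family `χ̄⟨χ̄^{p(p-1)}⟩`, sparse support
`castHom_pow_eq_one_of_apply_pow_eq_one_prime`) with the family moment
`exists_forall_family_exists_twistedSymbolSum_ne_zero_atkinLehner`.
[cite: RohrlichInventiones1984, Theorem (p. 409)] -/
theorem rohrlich_primePow_atkinLehner (hf : IsNewform0 f) (hQ : coeffField f = ⊥)
    {C θ : ℝ} (hC : 0 ≤ C) (hθ : 0 < θ) (hθ1 : θ < 2 / 3)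
    (ha : ∀ n : ℕ, ‖cuspCoeff f n‖ ≤ C * (n : ℝ) ^ θ)
    {Q : ℕ} [NeZero Q] (hQN : Q ∣ N) (hc : Nat.Coprime Q (N / Q)) {w : ℂ}
    (hw : atkinLehnerInvolution N 2 Q f = w • f) (hw1 : w ^ 2 = 1) (hpQ : ¬ p ∣ Q)
    {m₁ : ℕ} (hNm₁ : N ∣ Q * p ^ m₁) :
    Set.Finite {χ : Σ m : ℕ, DirichletCharacter ℂ m |
      χ.1 ≠ 0 ∧ χ.1.primeFactors ⊆ {p} ∧ χ.2.IsPrimitive ∧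
        ∃ L : ℂ → ℂ, Differentiable ℂ L ∧
          (∀ s : ℂ, 2 < s.re → L s = twistedLSeries f χ.2 s) ∧ L 1 = 0} := by
  classical
  have h1 : cuspCoeff f 1 = 1 := (isNormalized_iff_cuspCoeff_one f).mp hf.2.2
  obtain ⟨m₀, hm₀⟩ := exists_forall_family_exists_twistedSymbolSum_ne_zero_atkinLehner f hQN hc hw
    hw1 hpQ hNm₁ hC hθ hθ1 ha h1
  -- the finite set of characters of conductor `p^m`, `m < m₂ = max m₀ 1`
  set m₂ : ℕ := max m₀ 1 with hm₂
  have hfin : Set.Finite (⋃ m ∈ (↑(Finset.range m₂) : Set ℕ),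
      Set.range (Sigma.mk (β := fun n : ℕ ↦ DirichletCharacter ℂ n) (p ^ m))) := by
    refine (Finset.range m₂).finite_toSet.biUnion fun m _ ↦ ?_
    haveI : NeZero (p ^ m) := ⟨pow_ne_zero _ hp.out.ne_zero⟩
    exact Set.finite_range _
  refine hfin.subset ?_
  rintro ⟨n, ψ⟩ ⟨hn0, hP, hprim, L, hLd, hL, hL1⟩
  dsimp only at hn0 hP hprim hL hL1
  -- `n = p^m`
  obtain ⟨m, rfl⟩ : ∃ m, n = p ^ m := by
    refine ⟨_, Nat.eq_prime_pow_of_unique_prime_dvd hn0 fun {d} hd hdn ↦ ?_⟩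
    have : d ∈ ({p} : Finset ℕ) := hP (Nat.mem_primeFactors.mpr ⟨hd, hdn, hn0⟩)
    exact Finset.mem_singleton.mp this
  simp only [Set.mem_iUnion, Set.mem_range, Finset.coe_range, Set.mem_Iio]
  by_contra hmem
  push Not at hmem
  have hm : m₂ ≤ m := by
    by_contra hlt
    push Not at hlt
    exact hmem m hlt ψ rfl
  have hm0 : m ≠ 0 := by omega
  have hmm₀ : m₀ ≤ m := le_trans (le_max_left _ _) hm
  -- Birch's formula: `L(f, ψ, 1) = 0` gives `∑_a ψ̄(a){∞, a/p^m}_f = 0`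
  have hS : twistedSymbolSum f ψ⁻¹ = 0 := by
    have h := twisted_LValue_eq_holds f hprim hLd hL
    rw [hL1, mul_zero] at h
    exact h.symm
  set χ₁ : DirichletCharacter ℂ (p ^ m) := ψ⁻¹ with hχ₁
  have hprim₁ : χ₁.IsPrimitive := by
    rw [DirichletCharacter.isPrimitive_def, hχ₁, DirichletCharacter.conductor_inv]; exact hprim
  -- the Galois sub-coset `χ₁ ⟨χ₁^{p(p-1)}⟩`: primitive, constant parity, sparse support
  set Xf : Finset (DirichletCharacter ℂ (p ^ m)) :=
    (Finset.range (orderOf (χ₁ ^ (p * (p - 1))))).image (fun j ↦ χ₁ * (χ₁ ^ (p * (p - 1))) ^ j)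
    with hXf
  have hmem' : ∀ χ' ∈ Xf, ∃ j, χ' = χ₁ ^ (1 + p * (p - 1) * j) :=
    fun χ' h ↦ by
      obtain ⟨j, -, hj⟩ := (mem_galoisCoset_iff χ₁ (p * (p - 1))).mp h
      exact ⟨j, hj⟩
  have hX : ∀ χ' ∈ Xf, χ'.IsPrimitive ∧ χ' (-1) = χ₁ (-1) := by
    intro χ' h
    obtain ⟨j, rfl⟩ := hmem' χ' h
    have hcop := coprime_one_add_mul_orderOf hm0 χ₁ j
    exact ⟨isPrimitive_pow_of_coprime hm0 hprim₁ hcop, pow_apply_neg_one_of_coprime χ₁ hcop⟩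
  have hsupp : ∀ z : ZMod (p ^ m), ∑ χ ∈ Xf, χ z ≠ 0 →
      (ZMod.castHom (pow_dvd_pow p (Nat.sub_le m 1)) (ZMod (p ^ (m - 1))) z) ^ (2 * (p - 1)) = 1 := by
    intro z hz
    obtain ⟨hzu, hzr⟩ := isUnit_and_pow_eq_one_of_sum_galoisCoset_ne_zero χ₁ (p * (p - 1)) hz
    obtain ⟨u, rfl⟩ := hzu
    exact castHom_pow_eq_one_of_apply_pow_eq_one_prime hm0 hprim₁ hzr
  obtain ⟨χ', hχ', hne⟩ := hm₀ m hmm₀ Xf (χ₁ (-1)) (galoisCoset_nonempty χ₁ (p * (p - 1))) hX hsupp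
  -- `χ'⁻¹` is again a Galois conjugate of `χ₁ = ψ̄`, so its symbol sum vanishes: contradiction
  obtain ⟨j, rfl⟩ := hmem' χ' hχ'
  obtain ⟨hinv, hcop'⟩ := inv_pow_eq_pow_of_coprime χ₁ (coprime_one_add_mul_orderOf hm0 χ₁ j)
  rw [hinv] at hne
  exact hne (twistedSymbolSum_pow_eq_zero_of_coprime hf hQ hS hcop')

/-- **Rohrlich's non-vanishing theorem — rational newforms, twists of `p`-power conductor, ANY
prime `p`** (Rohrlich 1984, Theorem, p. 409, case `ψ = 1`, `P = {p}`, rational `f`; here with NO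
condition `p ∤ N`). Let `f ∈ S₂(Γ₀(N))` be a normalised newform with rational coefficients and
`|aₙ(f)| ≤ C n^θ` for some `θ < 2/3`. Then for every prime `p` only finitely many primitive Dirichlet
characters of `p`-power conductor have `L(f, χ, 1) = 0`: `rohrlich_primePow_atkinLehner` at the
prime-to-`p` part `Q = N/p^{v_p(N)}` (`ordCompl_exactDivisor`), the newform being a `w_Q`-eigenvector
with `w = ±1` (`IsNewform0.exists_atkinLehnerInvolution_eq_smul`). The tree's
`Rohrlich1984_primePow_of_coeffField_eq_bot` is the case `p ∤ N`.
[cite: RohrlichInventiones1984, Theorem (p. 409)] -/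
theorem rohrlich_primePow_of_coeffBound (hf : IsNewform0 f) (hQ : coeffField f = ⊥)
    {C θ : ℝ} (hC : 0 ≤ C) (hθ : 0 < θ) (hθ1 : θ < 2 / 3)
    (ha : ∀ n : ℕ, ‖cuspCoeff f n‖ ≤ C * (n : ℝ) ^ θ) :
    Set.Finite {χ : Σ m : ℕ, DirichletCharacter ℂ m |
      χ.1 ≠ 0 ∧ χ.1.primeFactors ⊆ {p} ∧ χ.2.IsPrimitive ∧
        ∃ L : ℂ → ℂ, Differentiable ℂ L ∧
          (∀ s : ℂ, 2 < s.re → L s = twistedLSeries f χ.2 s) ∧ L 1 = 0} := by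
  obtain ⟨hQN, hcop, hpQ, hNm⟩ := ordCompl_exactDivisor (p := p) (NeZero.ne N)
  haveI : NeZero (ordCompl[p] N) := ⟨(Nat.ordCompl_pos p (NeZero.ne N)).ne'⟩
  obtain ⟨w, hw1, hw⟩ := hf.exists_atkinLehnerInvolution_eq_smul hQN hcop
  have hw2 : w ^ 2 = 1 := by
    rcases hw1 with rfl | rfl <;> norm_num
  exact rohrlich_primePow_atkinLehner hf hQ hC hθ hθ1 ha hQN hcop hw hw2 hpQ hNm

/-- **Rohrlich's theorem for elliptic curves over `ℚ`: twists of `p`-power conductor, ANY prime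
`p`** (Rohrlich 1984, Theorem, p. 409 and the paper's title application, without `p ∤ N`; for `p ∣ N`
this is the elliptic-curve case of Rohrlich, Invent. Math. 97 (1989)). For `E = W/ℚ` elliptic,
`f ∈ S₂(Γ₀(N))` its newform (`IsNewformOf W f`) and ANY prime `p`, only finitely many primitive
Dirichlet characters `χ` of `p`-power conductor have `L(E, χ, 1) = L(f, χ, 1) = 0` — unconditionally
(Hasse `|aₙ(E)| ≤ 16^{256} n^{5/8}`, rationality `IsNewformOf.coeffField_eq_bot`, Eichler–Shimura /
Manin–Drinfeld / Atkin–Lehner theorems of the tree). [cite: RohrlichInventiones1984, Theorem (p. 409)] -/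
theorem rohrlich_primePow_of_isNewformOf {W : WeierstrassCurve ℚ} [W.IsElliptic]
    (hfW : IsNewformOf W f) :
    Set.Finite {χ : Σ m : ℕ, DirichletCharacter ℂ m |
      χ.1 ≠ 0 ∧ χ.1.primeFactors ⊆ {p} ∧ χ.2.IsPrimitive ∧
        ∃ L : ℂ → ℂ, Differentiable ℂ L ∧
          (∀ s : ℂ, 2 < s.re → L s = twistedLSeries f χ.2 s) ∧ L 1 = 0} :=
  rohrlich_primePow_of_coeffBound hfW.1 hfW.coeffField_eq_bot (C := (16 : ℝ) ^ 256)
    (θ := 5 / 8) (by positivity) (by norm_num) (by norm_num)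
    (fun n ↦ by rw [hfW.2 n]; exact W.norm_LFunction_le_rpow n)

end Main

end Summit.BirchSwinnertonDyer.BirchSwinnertonDyer.Theorems.PSRohrlichAtLevel

end
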